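import Summits.KontsevichZagierPeriods.KontsevichZagierPeriods.Theorems.LinRedNormalFormArrangementNormalFormSeparateEngine

/-!
# Far-first separation: the engine with a controlled order and the wall invariant

(Line `janus-bands`, crux `ArrangementNormalForm`, stub `stub_separateTwoZero` — separation in a
good rational direction for PLANAR arrangement representations without fibres; part `Induction`.)

`sepV_induction`: the separation engine `SeparatePos.sep_induction` (iterated rule (1b), every
piece dominated) for base dimension `1 + 1` without fibres, with the ORDER of the splittings
controlled — as long as an active letter misses the vertex `V`, it is split against another
active letter (the wall is then bounded away from zero on the cell); afterwards all active letters
pass through `V` and the new walls are walls through `V` (`vwall_of_near`, registered as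
`separateTwoZero_vwall`) — and the WALL INVARIANT handed to the terminal class: every wall is
harmless, or it passes through `V`, some letter is still active, all active letters pass through
`V`, and the cone condition at `V` holds.
-/

noncomputable section

open Set MeasureTheory Filter Topology
open scoped ENNReal

namespace Summit.KontsevichZagierPeriods.ArrangementNormalForm.JanusBands

open Literature.NumberTheory.Transcendental

namespace SepTwoZero

open SeparatePos

section Induction

variable {m' r : ℕ}

/-- Harmlessness of a wall is insensitive to its sign. -/
theorem harmless_neg {σ : Set (Fin (1 + 1 + 0) → ℝ)} {c c' : (Fin 1 → ℚ) × ℚ}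
    (h : ∃ c₀ > 0, ∀ z ∈ σ, c₀ ≤ |affB 1 0 (c - c') z|) :
    ∃ c₀ > 0, ∀ z ∈ σ, c₀ ≤ |affB 1 0 (c' - c) z| := by
  obtain ⟨c₀, hc₀, hb⟩ := h
  refine ⟨c₀, hc₀, fun z hz => ?_⟩
  rw [affB_sub, abs_sub_comm, ← affB_sub]; exact hb z hz

/-- A priori bound for `|y − λ(x)|` on a bounded cell. -/
theorem abs_sub_affB_le {σ : Set (Fin (1 + 1 + 0) → ℝ)} (hσ : Bornology.IsBounded σ)
    (c : (Fin 1 → ℚ) × ℚ) : ∃ R, ∀ z ∈ σ, |z (Fin.castAdd 0 (Fin.last 1)) - affB 1 0 c z| ≤ R := by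
  obtain ⟨R, hR⟩ := hσ.exists_norm_le
  refine ⟨R + (|(c.1 0 : ℝ)| * R + |(c.2 : ℝ)|), fun z hz => ?_⟩
  have h1 : ∀ j, |z j| ≤ R := fun j => le_trans (by simp [← Real.norm_eq_abs, norm_le_pi_norm]) (hR z hz)
  have hB : |affB 1 0 c z| ≤ |(c.1 0 : ℝ)| * R + |(c.2 : ℝ)| := by
    simp only [affB, Fin.sum_univ_one]
    refine (abs_add_le _ _).trans (add_le_add ?_ le_rfl)
    rw [abs_mul]; exact mul_le_mul_of_nonneg_left (h1 _) (abs_nonneg _)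
  calc _ ≤ |z (Fin.castAdd 0 (Fin.last 1))| + |affB 1 0 c z| := abs_sub _ _
    _ ≤ _ := add_le_add (h1 _) hB

/-- The ratio condition of a far pair from harmlessness of its wall. -/
theorem ratio_of_harmless {σ : Set (Fin (1 + 1 + 0) → ℝ)} (hσ : Bornology.IsBounded σ)
    {c c' : (Fin 1 → ℚ) × ℚ} (h : ∃ c₀ > 0, ∀ z ∈ σ, c₀ ≤ |affB 1 0 (c - c') z|) :
    ∃ C, ∀ z ∈ σ, |z (Fin.castAdd 0 (Fin.last 1)) - affB 1 0 c' z| ≤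
      C * |affB 1 0 c z - affB 1 0 c' z| := by
  obtain ⟨c₀, hc₀, hb⟩ := h
  obtain ⟨R, hR⟩ := abs_sub_affB_le hσ c'
  refine ⟨R / c₀, fun z hz => ?_⟩
  have h1 := hb z hz
  rw [affB_sub] at h1
  have hR0 : 0 ≤ R := (abs_nonneg _).trans (hR z hz)
  calc _ ≤ R := hR z hz
    _ = R / c₀ * c₀ := by field_simp
    _ ≤ R / c₀ * |affB 1 0 c z - affB 1 0 c' z| := mul_le_mul_of_nonneg_left h1 (by positivity)

/-- Two distinct letters through `V` have a wall through `V`. -/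
theorem vwall_of_near {V : ℚ × ℚ} {c c' : (Fin 1 → ℚ) × ℚ} (hc : c.1 0 * V.1 + c.2 = V.2)
    (hc' : c'.1 0 * V.1 + c'.2 = V.2)
    (hne : c ≠ c') : (c - c').1 0 ≠ 0 ∧ (c - c').1 0 * V.1 + (c - c').2 = 0 := by
  refine ⟨fun h => hne ?_, ?_⟩
  · have h1 : c.1 0 = c'.1 0 := by simpa [sub_eq_zero] using h
    have h2 : c.2 = c'.2 := by rw [h1] at hc; linarith
    exact Prod.ext (funext fun i => by fin_cases i; exact h1) h2
  · simp only [Prod.fst_sub, Prod.snd_sub, Pi.sub_apply]; linarith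

/-- **Far-first separation** (the engine `SeparatePos.sep_induction` with a controlled order of
the splittings and the wall invariant): as long as an active letter misses the vertex `V`,
split it against another active letter (harmless wall); afterwards all active letters pass
through `V` and the new walls are walls through `V`. -/
theorem sepV_induction (m' r : ℕ) (M : Fin m' → (Fin (1 + 1) → ℚ) × ℚ)
    (p : MvPolynomial (Fin (1 + 1)) ℚ) (lam : Fin r → (Fin 1 → ℚ) × ℚ)
    (a : Fin 0 → Option ((Fin (1 + 1) → ℚ) × ℚ))
    (lo up : Fin 0 → Fin 0 ⊕ ((Fin (1 + 1) → ℚ) × ℚ)) (V : ℚ × ℚ) (act : Fin r → Prop)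
    (T : Set KZ.FormalRep)
    (hT : ∀ (m : ℕ) (L : Fin m → (Fin 1 → ℚ) × ℚ) (e : Fin m → ℕ) (d : Fin r → ℕ)
      (s : KZ.IntegralRep (1 + 1 + 0)) (ℓ : (Fin 1 → ℚ) × ℚ), Bornology.IsBounded s.domain →
      s.domain = gDom 1 0 m' M lo up → EqOn s.integrand (shape 1 0 p L e lam d a) s.domain →
      (∀ j, d j ≠ 0 → ∀ z ∈ s.domain, z (Fin.castAdd 0 (Fin.last 1)) - affB 1 0 (lam j) z ≠ 0) →
      (∀ j, d j ≠ 0 → lam j = ℓ) →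
      (∀ l, e l ≠ 0 → (∃ c₀ > 0, ∀ z ∈ s.domain, c₀ ≤ |affB 1 0 (L l) z|) ∨
        (((L l).1 0 ≠ 0 ∧ (L l).1 0 * V.1 + (L l).2 = 0 ∧ (∃ i, d i ≠ 0) ∧
          (∀ i, d i ≠ 0 → ((lam i).1 0 * V.1 + (lam i).2 = V.2)) ∧
          (∃ a₁ b₁ : ℚ, ∀ z ∈ s.domain, (a₁ : ℝ) * (z 0 - V.1) < z 1 - V.2 ∧ z 1 - V.2 < (b₁ : ℝ) * (z 0 - V.1))))) →
      KZ.of s ∈ T)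
    (hfar : ∀ j j', act j → act j' → ¬ ((lam j).1 0 * V.1 + (lam j).2 = V.2) → lam j ≠ lam j' →
      (∃ c₀ > 0, ∀ z ∈ gDom 1 0 m' M lo up, c₀ ≤ |affB 1 0 (lam j - lam j') z|))
    (hnear : ∀ j j', act j → act j' → ((lam j).1 0 * V.1 + (lam j).2 = V.2) →
      ((lam j').1 0 * V.1 + (lam j').2 = V.2) → lam j ≠ lam j' →
      (∃ C, ∀ z ∈ gDom 1 0 m' M lo up, |z (Fin.castAdd 0 (Fin.last 1)) - affB 1 0 (lam j') z| ≤
        C * |affB 1 0 (lam j) z - affB 1 0 (lam j') z|) ∧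
      (∃ a₁ b₁ : ℚ, ∀ z ∈ gDom 1 0 m' M lo up, (a₁ : ℝ) * (z 0 - V.1) < z 1 - V.2 ∧ z 1 - V.2 < (b₁ : ℝ) * (z 0 - V.1)))
    (N : ℕ) :
    ∀ (m : ℕ) (L : Fin m → (Fin 1 → ℚ) × ℚ) (e : Fin m → ℕ) (d : Fin r → ℕ)
      (s : KZ.IntegralRep (1 + 1 + 0)), ∑ j, d j = N → Bornology.IsBounded s.domain →
      s.domain = gDom 1 0 m' M lo up → EqOn s.integrand (shape 1 0 p L e lam d a) s.domain →
      (∀ j, d j ≠ 0 → ∀ z ∈ s.domain, z (Fin.castAdd 0 (Fin.last 1)) - affB 1 0 (lam j) z ≠ 0) →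
      (∀ j, d j ≠ 0 → act j) →
      (∀ l, e l ≠ 0 → (∃ c₀ > 0, ∀ z ∈ s.domain, c₀ ≤ |affB 1 0 (L l) z|) ∨
        (((L l).1 0 ≠ 0 ∧ (L l).1 0 * V.1 + (L l).2 = 0 ∧ (∃ i, d i ≠ 0) ∧
          (∀ i, d i ≠ 0 → ((lam i).1 0 * V.1 + (lam i).2 = V.2)) ∧
          (∃ a₁ b₁ : ℚ, ∀ z ∈ s.domain, (a₁ : ℝ) * (z 0 - V.1) < z 1 - V.2 ∧ z 1 - V.2 < (b₁ : ℝ) * (z 0 - V.1))))) →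
      ∃ c ∈ AddSubgroup.closure T, KZ.of s - c ∈ KZ.relations := by
  induction N with
  | zero =>
    intro m L e d s hN hbd hdom hint hpole _ hinv
    have hd : ∀ j, d j = 0 := fun j => (Finset.sum_eq_zero_iff.mp hN) j (Finset.mem_univ j)
    exact ⟨KZ.of s, AddSubgroup.subset_closure (hT m L e d s 0 hbd hdom hint hpole
      (fun j hj => absurd (hd j) hj) hinv), by simp⟩
  | succ N ih =>
    intro m L e d s hN hbd hdom hint hpole hact hinv
    -- one splitting step, given a pair and the two ratio conditions and the status of the walls
    have step : ∀ j j', d j ≠ 0 → d j' ≠ 0 → lam j ≠ lam j' →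
        (∃ C, ∀ z ∈ s.domain, |z (Fin.castAdd 0 (Fin.last 1)) - affB 1 0 (lam j') z| ≤
          C * |affB 1 0 (lam j) z - affB 1 0 (lam j') z|) →
        (∃ C, ∀ z ∈ s.domain, |z (Fin.castAdd 0 (Fin.last 1)) - affB 1 0 (lam j) z| ≤
          C * |affB 1 0 (lam j') z - affB 1 0 (lam j) z|) →
        (∀ d' : Fin r → ℕ, (∀ i, d' i ≠ 0 → d i ≠ 0) → (∃ i, d' i ≠ 0) →
          (∀ l, (Fin.snoc e 1 : Fin (m + 1) → ℕ) l ≠ 0 → (∃ c₀ > 0, ∀ z ∈ s.domain, c₀ ≤ |affB 1 0 ((Fin.snoc L (lam j - lam j') : Fin (m + 1) → (Fin 1 → ℚ) × ℚ) l) z|) ∨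
        ((((Fin.snoc L (lam j - lam j') : Fin (m + 1) → (Fin 1 → ℚ) × ℚ) l).1 0 ≠ 0 ∧ ((Fin.snoc L (lam j - lam j') : Fin (m + 1) → (Fin 1 → ℚ) × ℚ) l).1 0 * V.1 + ((Fin.snoc L (lam j - lam j') : Fin (m + 1) → (Fin 1 → ℚ) × ℚ) l).2 = 0 ∧ (∃ i, d' i ≠ 0) ∧
          (∀ i, d' i ≠ 0 → ((lam i).1 0 * V.1 + (lam i).2 = V.2)) ∧
          (∃ a₁ b₁ : ℚ, ∀ z ∈ s.domain, (a₁ : ℝ) * (z 0 - V.1) < z 1 - V.2 ∧ z 1 - V.2 < (b₁ : ℝ) * (z 0 - V.1))))) ∧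
          (∀ l, (Fin.snoc e 1 : Fin (m + 1) → ℕ) l ≠ 0 → (∃ c₀ > 0, ∀ z ∈ s.domain, c₀ ≤ |affB 1 0 ((Fin.snoc L (lam j' - lam j) : Fin (m + 1) → (Fin 1 → ℚ) × ℚ) l) z|) ∨
        ((((Fin.snoc L (lam j' - lam j) : Fin (m + 1) → (Fin 1 → ℚ) × ℚ) l).1 0 ≠ 0 ∧ ((Fin.snoc L (lam j' - lam j) : Fin (m + 1) → (Fin 1 → ℚ) × ℚ) l).1 0 * V.1 + ((Fin.snoc L (lam j' - lam j) : Fin (m + 1) → (Fin 1 → ℚ) × ℚ) l).2 = 0 ∧ (∃ i, d' i ≠ 0) ∧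
          (∀ i, d' i ≠ 0 → ((lam i).1 0 * V.1 + (lam i).2 = V.2)) ∧
          (∃ a₁ b₁ : ℚ, ∀ z ∈ s.domain, (a₁ : ℝ) * (z 0 - V.1) < z 1 - V.2 ∧ z 1 - V.2 < (b₁ : ℝ) * (z 0 - V.1)))))) →
        ∃ c ∈ AddSubgroup.closure T, KZ.of s - c ∈ KZ.relations := by
      intro j j' hj hj' hne hC1 hC2 hinv'
      obtain ⟨C₁, hC₁⟩ := hC1
      obtain ⟨C₂, hC₂⟩ := hC2
      obtain ⟨s₁, hd₁, hg₁, hi₁⟩ := exists_piece L e p lam d a s hint j j' hj' (hpole j' hj') hC₁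
      obtain ⟨s₂, hd₂, hg₂, hi₂⟩ := exists_piece L e p lam d a s hint j' j hj (hpole j hj) hC₂
      have hrel : KZ.of s - KZ.of s₁ - KZ.of s₂ ∈ KZ.relations := by
        refine KZ.integrandAddRel_subset_relations ⟨_, s, s₁, s₂, hd₁, hd₂, fun z hz => ?_, rfl⟩
        have hR : affB 1 0 (lam j) z - affB 1 0 (lam j') z ≠ 0 := fun h => hpole j' hj' z hz
          (abs_eq_zero.mp (le_antisymm (by simpa [h] using hC₁ z hz) (abs_nonneg _)))
        have key : (z (Fin.castAdd 0 (Fin.last 1)) - affB 1 0 (lam j') z) /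
              (affB 1 0 (lam j) z - affB 1 0 (lam j') z) +
            (z (Fin.castAdd 0 (Fin.last 1)) - affB 1 0 (lam j) z) /
              (affB 1 0 (lam j') z - affB 1 0 (lam j) z) = 1 := by
          rw [show affB 1 0 (lam j') z - affB 1 0 (lam j) z =
              -(affB 1 0 (lam j) z - affB 1 0 (lam j') z) by ring, div_neg, ← sub_eq_add_neg,
            ← sub_div, div_eq_one_iff_eq hR]
          ring
        rw [Pi.add_apply, hg₁, hg₂, ← mul_add, key, mul_one]
      have hsum : ∀ i : Fin r, d i ≠ 0 → ∑ l, Function.update d i (d i - 1) l = N := by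
        intro i hi
        rw [Finset.sum_update_of_mem (Finset.mem_univ _)]
        have h1 := Finset.sum_eq_add_sum_sdiff_singleton_of_mem (Finset.mem_univ i) d
        omega
      have hex : ∀ i : Fin r, d i ≠ 0 → ∃ l, Function.update d i (d i - 1) l ≠ 0 := by
        intro i hi
        by_contra hall; push Not at hall
        have h0 : ∑ l, Function.update d i (d i - 1) l = 0 := Finset.sum_eq_zero fun l _ => hall l
        rw [hsum i hi] at h0
        have h2 : ∑ l, d l ≥ 2 := by
          have hjj' : j ≠ j' := fun h => hne (h ▸ rfl)
          have := Finset.add_le_sum (f := d) (fun _ _ => Nat.zero_le _) (Finset.mem_univ j)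
            (Finset.mem_univ j') hjj'
          omega
        omega
      obtain ⟨hI₁, -⟩ := hinv' _ (fun i => ne_zero_of_update_ne_zero) (hex j' hj')
      obtain ⟨-, hI₂⟩ := hinv' _ (fun i => ne_zero_of_update_ne_zero) (hex j hj)
      obtain ⟨c₁, hc₁, hr₁⟩ := ih (m + 1) _ _ _ s₁ (hsum j' hj') (by rw [hd₁]; exact hbd)
        (hd₁.trans hdom) hi₁
        (fun i hi z hz => hpole i (ne_zero_of_update_ne_zero hi) z (by rw [← hd₁]; exact hz))
        (fun i hi => hact i (ne_zero_of_update_ne_zero hi)) (by rw [hd₁]; exact hI₁)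
      obtain ⟨c₂, hc₂, hr₂⟩ := ih (m + 1) _ _ _ s₂ (hsum j hj) (by rw [hd₂]; exact hbd)
        (hd₂.trans hdom) hi₂
        (fun i hi z hz => hpole i (ne_zero_of_update_ne_zero hi) z (by rw [← hd₂]; exact hz))
        (fun i hi => hact i (ne_zero_of_update_ne_zero hi)) (by rw [hd₂]; exact hI₂)
      refine ⟨c₁ + c₂, add_mem hc₁ hc₂, ?_⟩
      have : KZ.of s - (c₁ + c₂) =
          (KZ.of s - KZ.of s₁ - KZ.of s₂) + (KZ.of s₁ - c₁) + (KZ.of s₂ - c₂) := by abel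
      rw [this]
      exact add_mem (add_mem hrel hr₁) hr₂
    -- status of the old walls is inherited
    have hold : ∀ (d' : Fin r → ℕ), (∀ i, d' i ≠ 0 → d i ≠ 0) → (∃ i, d' i ≠ 0) →
        ∀ w : (Fin 1 → ℚ) × ℚ, ((∃ c₀ > 0, ∀ z ∈ s.domain, c₀ ≤ |affB 1 0 w z|) ∨ ((w.1 0 ≠ 0 ∧ w.1 0 * V.1 + w.2 = 0) ∧
          (∀ i, d' i ≠ 0 → ((lam i).1 0 * V.1 + (lam i).2 = V.2)) ∧
          (∃ a₁ b₁ : ℚ, ∀ z ∈ s.domain, (a₁ : ℝ) * (z 0 - V.1) < z 1 - V.2 ∧ z 1 - V.2 < (b₁ : ℝ) * (z 0 - V.1)))) →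
        (∀ l, (Fin.snoc e 1 : Fin (m + 1) → ℕ) l ≠ 0 → (∃ c₀ > 0, ∀ z ∈ s.domain, c₀ ≤ |affB 1 0 ((Fin.snoc L w : Fin (m + 1) → (Fin 1 → ℚ) × ℚ) l) z|) ∨
        ((((Fin.snoc L w : Fin (m + 1) → (Fin 1 → ℚ) × ℚ) l).1 0 ≠ 0 ∧ ((Fin.snoc L w : Fin (m + 1) → (Fin 1 → ℚ) × ℚ) l).1 0 * V.1 + ((Fin.snoc L w : Fin (m + 1) → (Fin 1 → ℚ) × ℚ) l).2 = 0 ∧ (∃ i, d' i ≠ 0) ∧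
          (∀ i, d' i ≠ 0 → ((lam i).1 0 * V.1 + (lam i).2 = V.2)) ∧
          (∃ a₁ b₁ : ℚ, ∀ z ∈ s.domain, (a₁ : ℝ) * (z 0 - V.1) < z 1 - V.2 ∧ z 1 - V.2 < (b₁ : ℝ) * (z 0 - V.1))))) := by
      intro d' hd' hex w hw l hl
      refine Fin.lastCases ?_ (fun l => ?_) l hl
      · intro _
        simp only [Fin.snoc_last]
        rcases hw with h | ⟨⟨h1, h2⟩, h3, h4⟩
        · exact Or.inl h
        · exact Or.inr ⟨h1, h2, hex, h3, h4⟩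
      · intro hl
        simp only [Fin.snoc_castSucc] at hl ⊢
        rcases hinv l hl with h | ⟨h1, h2, _, h4, h5⟩
        · exact Or.inl h
        · exact Or.inr ⟨h1, h2, hex, fun i hi => h4 i (hd' i hi), h5⟩
    by_cases hph1 : ∃ j j', d j ≠ 0 ∧ d j' ≠ 0 ∧ ¬ ((lam j).1 0 * V.1 + (lam j).2 = V.2) ∧ lam j ≠ lam j'
    · -- Phase 1: a far active letter against any other active letter
      obtain ⟨j, j', hj, hj', hfarj, hne⟩ := hph1
      have hw : (∃ c₀ > 0, ∀ z ∈ s.domain, c₀ ≤ |affB 1 0 (lam j - lam j') z|) := by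
        rw [hdom]; exact hfar j j' (hact j hj) (hact j' hj') hfarj hne
      refine step j j' hj hj' hne (ratio_of_harmless hbd hw) (ratio_of_harmless hbd
        (harmless_neg hw)) fun d' hd' hex => ⟨hold d' hd' hex _ (Or.inl hw),
          hold d' hd' hex _ (Or.inl (harmless_neg hw))⟩
    · by_cases hsplit : ∃ j j', d j ≠ 0 ∧ d j' ≠ 0 ∧ lam j ≠ lam j'
      · -- Phase 2: all active letters pass through `V`
        obtain ⟨j, j', hj, hj', hne⟩ := hsplit
        push Not at hph1
        have hnj : ((lam j).1 0 * V.1 + (lam j).2 = V.2) := by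
          by_contra h; exact hne (hph1 j j' hj hj' h)
        have hnall : ∀ i, d i ≠ 0 → ((lam i).1 0 * V.1 + (lam i).2 = V.2) := fun i hi => by
          by_contra h
          by_cases hij : lam i = lam j
          · exact h (hij ▸ hnj)
          · exact hij (hph1 i j hi hj h)
        have hnj' := hnall j' hj'
        obtain ⟨hr1, hcone⟩ := hnear j j' (hact j hj) (hact j' hj') hnj hnj' hne
        obtain ⟨hr2, -⟩ := hnear j' j (hact j' hj') (hact j hj) hnj' hnj hne.symm
        rw [← hdom] at hr1 hr2 hcone
        refine step j j' hj hj' hne hr1 hr2 fun d' hd' hex =>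
          ⟨hold d' hd' hex _ (Or.inr ⟨vwall_of_near hnj hnj' hne, fun i hi => hnall i (hd' i hi),
            hcone⟩),
           hold d' hd' hex _ (Or.inr ⟨vwall_of_near hnj' hnj hne.symm,
            fun i hi => hnall i (hd' i hi), hcone⟩)⟩
      · -- terminal
        push Not at hsplit
        have hℓ : ∃ ℓ, ∀ j, d j ≠ 0 → lam j = ℓ := by
          by_cases h : ∃ j, d j ≠ 0
          · obtain ⟨j₀, hj₀⟩ := h
            exact ⟨lam j₀, fun j hj => hsplit j j₀ hj hj₀⟩
          · push Not at h
            exact ⟨0, fun j hj => absurd (h j) hj⟩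
        obtain ⟨ℓ, hℓ⟩ := hℓ
        exact ⟨KZ.of s, AddSubgroup.subset_closure (hT m L e d s ℓ hbd hdom hint hpole hℓ hinv),
          by simp⟩

end Induction

end SepTwoZero

open SepTwoZero SeparatePos in
/-- **Two distinct letters through a vertex have a wall through it** (registered sub-goal of `stub_separateTwoZero`). -/
theorem separateTwoZero_vwall (V : ℚ × ℚ) (c c' : (Fin 1 → ℚ) × ℚ) (hc : c.1 0 * V.1 + c.2 = V.2) (hc' : c'.1 0 * V.1 + c'.2 = V.2) (hne : c ≠ c') : (c - c').1 0 ≠ 0 ∧ (c - c').1 0 * V.1 + (c - c').2 = 0 := by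
  exact vwall_of_near hc hc' hne

end Summit.KontsevichZagierPeriods.ArrangementNormalForm.JanusBands
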